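import Summits.QuantumFields.YangMills.Theses.SqueezedSkewness
import HarnessLib

/-!
# Route `SqueezedSkewness`, support `LowPassFloorHVacuumRow` (stmt-QuantumFields-23245) — BY NAME

`LowPassFloor → ThermalFraction → LowPassFloorH` (g10 LINE β «vacuum row» of planner ym-idea-6): the hypercube low-pass
floor from the cylinder floor and the thermal (vacuum) fraction, with `ε' = c₀·ε`, `β₅' = max β₅ β₆`, `Λ₅' = max Λ₅ Λ₆`,
and, for each `δ > 0`, a `k` beyond both the floor's `k₀` and the eventual range of the thermal fraction
(`le_of_forall_pos_le_add`).  This is the free-landable port of the planner's kernel-checked composition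
`LowPassFloorH_of` (crux workfile `Cruxes/NT/Lines/low_pass_floor_h_birth.lean`), stated against the route decls so that
the item closes by name.

Free-hands width seat `ym-line-sfw-p2-w4` (cell ym-idea-1).  R2a RECORD-rung plumbing only: no summit, rung or crux is
proved here and nothing about the Yang–Mills mass gap follows.
-/

set_option autoImplicit false

namespace Summit.QuantumFields.YangMills.Theorems.SqueezedSkewnessLowPassFloorHVacuumRow

open Summit.QuantumFields.YangMills.Theses.SqueezedSkewness

/-- **`LowPassFloorHVacuumRow`** (item stmt-QuantumFields-23245), BY NAME: `LowPassFloor → ThermalFraction → LowPassFloorH`.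
[folklore] -/
theorem lowPassFloorHVacuumRow_proof :
    Summit.QuantumFields.YangMills.Theses.SqueezedSkewness.LowPassFloorHVacuumRow := by
  intro h1 h2 G _ _ _ _ hG
  obtain ⟨r, a, hra⟩ := h1 G hG
  refine ⟨r, a, ?_⟩
  intro St Cfg P A w E Cov refl
  obtain ⟨ha, ha0, hfl⟩ := hra
  refine ⟨ha, ha0, ?_⟩
  intro lp κ Bc ind kap M
  obtain ⟨ε, β₅, Λ₅, hε, hfl⟩ := hfl
  obtain ⟨c₀, β₆, Λ₆, hc₀, htf⟩ := h2 G hG r a ⟨ε, β₅, Λ₅, hε, hfl⟩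
  refine ⟨c₀ * ε, max β₅ β₆, max Λ₅ Λ₆, mul_pos hc₀ hε, fun β hβ L hL => ?_⟩
  obtain ⟨k₀, hk⟩ := hfl β (le_of_max_le_left hβ) L ((le_max_left _ _).trans hL)
  have htf' := htf β (le_of_max_le_right hβ) L ((le_max_right _ _).trans hL)
  refine le_of_forall_pos_le_add fun δ hδ => ?_
  obtain ⟨k, hk1, hk2⟩ := ((htf' δ hδ).and (Filter.eventually_ge_atTop k₀)).exists
  calc c₀ * ε * a β ^ 8 = c₀ * (ε * a β ^ 8) := by ring
    _ ≤ c₀ * M β (2 * L + 1) (2 ^ k * (2 * L + 1)) (a β) (Nat.floor (5 / (2 * a β)) + 1) :=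
        mul_le_mul_of_nonneg_left (hk k hk2) hc₀.le
    _ ≤ M β (2 * L + 1) (2 * L + 1) (a β) (Nat.floor (5 / (2 * a β)) + 1) + δ := hk1

end Summit.QuantumFields.YangMills.Theorems.SqueezedSkewnessLowPassFloorHVacuumRow
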